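import Mathlib.Data.Real.Basic
import Mathlib.Algebra.BigOperators.Ring.Finset
import Mathlib.Algebra.Order.BigOperators.Group.Finset
import Mathlib.Order.Monotone.Basic
import Mathlib.Tactic.Linarith
import Mathlib.Tactic.Ring
import HarnessLib

/-!
# Parallel composition for the coefficientwise first rung: the kernel property tensorises

Support file (`--supports stmt-CriticalPhenomena-4575`, closed), prover `prim-lf-2` (gen 25).  No definitions, no named facts, no sorries; standard axioms.
Memo `prim-lf-2/CW-MARTINGALE-gen25.md` §4.3 and §8(a) (THEOREM SP, parallel step).

For a finite 'kernel' `N : α → α → ℝ≥0` (in the application: `N(W,W')` = number of two-colourings with red cluster `W` and blue cluster `W'` of the root, restricted to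
the wall event) say `N` has the KERNEL PROPERTY if `Σ_{a,a'} N a a' · F a · (G a − G a') ≥ 0` for all monotone `F, G` — for a symmetric `N` this is exactly
`Σ N(a,a')(F a − F a')(G a − G a') ≥ 0`, i.e. membership of the rooted graph in the class `𝒞` of the memo (CW-PA(z) for all increasing f,g).  Gluing two graphs at
`{x,z}` multiplies the kernels (the two sides are independent under the wall measure and the clusters are unions), and the lemma below shows that the kernel property
of the factors implies that of the product kernel for ALL coordinatewise-monotone `F, G` on the product — THEOREM SP (a): `𝒞` is closed under parallel composition.
[cite: KozmaNitzan2024, Questions 8–9 (§5.5 p. 36) (context: first rung of the coefficientwise programme for Question 8)]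
-/

namespace Summit.CriticalPhenomena.PercolationContinuityZ3.Theorems

open Finset

namespace Coefficientwise

variable {α β : Type*} [Fintype α] [Fintype β] [Preorder α] [Preorder β]

/-- **Tensorisation of the kernel property** (parallel composition at `{x,z}`, THEOREM SP (a) of `prim-lf-2/CW-MARTINGALE-gen25.md` §8).
If nonnegative kernels `N₁` on `α` and `N₂` on `β` both satisfy `Σ N a a'·F a·(G a − G a') ≥ 0` for all monotone `F, G`, then so does the product kernel
`N₁ a a' · N₂ b b'` for all `F, G : α → β → ℝ` monotone in each coordinate.
[cite: KozmaNitzan2024, §5.5 (context only; the statement is elementary)] -/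
theorem kernel_tensor (N₁ : α → α → ℝ) (N₂ : β → β → ℝ)
    (hN₁ : ∀ a a', 0 ≤ N₁ a a') (hN₂ : ∀ b b', 0 ≤ N₂ b b')
    (h₁ : ∀ F G : α → ℝ, Monotone F → Monotone G → 0 ≤ ∑ a, ∑ a', N₁ a a' * (F a * (G a - G a')))
    (h₂ : ∀ F G : β → ℝ, Monotone F → Monotone G → 0 ≤ ∑ b, ∑ b', N₂ b b' * (F b * (G b - G b')))
    (F G : α → β → ℝ)
    (hFa : ∀ b, Monotone (fun a => F a b)) (hFb : ∀ a, Monotone (F a))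
    (hGa : ∀ b, Monotone (fun a => G a b)) (hGb : ∀ a, Monotone (G a)) :
    0 ≤ ∑ a, ∑ b, ∑ a', ∑ b', N₁ a a' * N₂ b b' * (F a b * (G a b - G a' b')) := by
  -- split  G a b − G a' b' = (G a b − G a' b) + (G a' b − G a' b')
  have split : ∀ a b a' b', N₁ a a' * N₂ b b' * (F a b * (G a b - G a' b'))
      = N₂ b b' * (N₁ a a' * (F a b * (G a b - G a' b)))
        + N₂ b b' * ((N₁ a a' * F a b) * (G a' b - G a' b')) := by
    intros; ring
  simp_rw [split, Finset.sum_add_distrib]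
  apply add_nonneg
  · -- first part: regroup as Σ_b Σ_b' N₂ b b' · (Σ_a Σ_a' …) and use the α-kernel property for F(·,b), G(·,b)
    have inner : ∀ a b, (∑ a', ∑ b', N₂ b b' * (N₁ a a' * (F a b * (G a b - G a' b))))
        = ∑ b', ∑ a', N₂ b b' * (N₁ a a' * (F a b * (G a b - G a' b))) := fun a b => Finset.sum_comm
    simp_rw [inner]
    -- now Σ_a Σ_b Σ_b' Σ_a' ; swap a past b and b'
    have mid : ∀ a, (∑ b, ∑ b', ∑ a', N₂ b b' * (N₁ a a' * (F a b * (G a b - G a' b))))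
        = ∑ b, ∑ b', N₂ b b' * ∑ a', N₁ a a' * (F a b * (G a b - G a' b)) := by
      intro a
      refine Finset.sum_congr rfl fun b _ => Finset.sum_congr rfl fun b' _ => ?_
      rw [Finset.mul_sum]
    simp_rw [mid]
    rw [Finset.sum_comm]
    refine Finset.sum_nonneg fun b _ => ?_
    rw [Finset.sum_comm]
    refine Finset.sum_nonneg fun b' _ => ?_
    rw [← Finset.mul_sum]
    exact mul_nonneg (hN₂ b b') (h₁ (fun a => F a b) (fun a => G a b) (hFa b) (hGa b))
  · -- second part: regroup as Σ_a' Σ_b Σ_b' N₂ b b' · (Σ_a N₁ a a' F a b) · (G a' b − G a' b') and use the β-kernel property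
    have inner : ∀ a b, (∑ a', ∑ b', N₂ b b' * ((N₁ a a' * F a b) * (G a' b - G a' b')))
        = ∑ a', ∑ b', (N₁ a a' * F a b) * (N₂ b b' * (G a' b - G a' b')) := by
      intro a b
      exact Finset.sum_congr rfl fun a' _ => Finset.sum_congr rfl fun b' _ => by ring
    simp_rw [inner]
    -- Σ_a Σ_b Σ_a' Σ_b' (N₁ a a' F a b) (N₂ b b' (G a' b − G a' b'))  →  Σ_a' Σ_b Σ_b' (Σ_a N₁ a a' F a b) …
    have swap_ab : ∀ a, (∑ b, ∑ a', ∑ b', (N₁ a a' * F a b) * (N₂ b b' * (G a' b - G a' b')))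
        = ∑ a', ∑ b, ∑ b', (N₁ a a' * F a b) * (N₂ b b' * (G a' b - G a' b')) := fun a => Finset.sum_comm
    simp_rw [swap_ab]
    rw [Finset.sum_comm]
    refine Finset.sum_nonneg fun a' _ => ?_
    -- goal: 0 ≤ Σ_a Σ_b Σ_b' (N₁ a a' F a b)(N₂ b b' (G a' b − G a' b'))
    have regroup : (∑ a, ∑ b, ∑ b', (N₁ a a' * F a b) * (N₂ b b' * (G a' b - G a' b')))
        = ∑ b, ∑ b', N₂ b b' * ((∑ a, N₁ a a' * F a b) * (G a' b - G a' b')) := by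
      rw [Finset.sum_comm]
      refine Finset.sum_congr rfl fun b _ => ?_
      rw [Finset.sum_comm]
      refine Finset.sum_congr rfl fun b' _ => ?_
      rw [Finset.sum_mul, Finset.mul_sum]
      exact Finset.sum_congr rfl fun a _ => by ring
    rw [regroup]
    refine h₂ (fun b => ∑ a, N₁ a a' * F a b) (fun b => G a' b) ?_ (hGb a')
    intro b b' hbb'
    exact Finset.sum_le_sum fun a _ => mul_le_mul_of_nonneg_left (hFb a hbb') (hN₁ a a')

omit [Fintype β] [Preorder α] [Preorder β] in
/-- Symmetric kernels: the kernel property in the form used by `kernel_tensor` is the same as nonnegativity of the symmetric bilinear form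
`Σ N a a' (F a − F a')(G a − G a')` (twice the former), which is how CW-PA(z) = `T'(z) ≥ 0` is stated in the memo.
[cite: KozmaNitzan2024, §5.5 (context only)] -/
theorem kernel_symm_form (N : α → α → ℝ) (hsymm : ∀ a a', N a a' = N a' a) (F G : α → ℝ) :
    ∑ a, ∑ a', N a a' * ((F a - F a') * (G a - G a')) = 2 * ∑ a, ∑ a', N a a' * (F a * (G a - G a')) := by
  have h1 : ∑ a, ∑ a', N a a' * ((F a - F a') * (G a - G a'))
      = ∑ a, ∑ a', N a a' * (F a * (G a - G a')) + ∑ a, ∑ a', N a a' * (F a' * (G a' - G a)) := by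
    rw [← Finset.sum_add_distrib]
    refine Finset.sum_congr rfl fun a _ => ?_
    rw [← Finset.sum_add_distrib]
    exact Finset.sum_congr rfl fun a' _ => by ring
  have h2 : ∑ a, ∑ a', N a a' * (F a' * (G a' - G a)) = ∑ a, ∑ a', N a a' * (F a * (G a - G a')) := by
    rw [Finset.sum_comm]
    exact Finset.sum_congr rfl fun a _ => Finset.sum_congr rfl fun a' _ => by rw [hsymm a' a]
  rw [h1, h2]; ring

end Coefficientwise

end Summit.CriticalPhenomena.PercolationContinuityZ3.Theorems
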